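import Mathlib.Analysis.Normed.Operator.Compact.FredholmAlternative
import Mathlib.Analysis.Normed.Operator.Banach
import Mathlib.Analysis.Normed.Module.HahnBanach
import Mathlib.Analysis.Calculus.ImplicitContDiff
import Mathlib.Analysis.Calculus.FDeriv.Prod
import Mathlib.Analysis.Calculus.FDeriv.Add
import Mathlib.Analysis.Calculus.Deriv.Comp
import Mathlib.Analysis.Calculus.Deriv.Add
import Mathlib.Analysis.Calculus.Deriv.Mul
import HarnessLib

/-!
# The bordering lemma and the bordered implicit function theorem (Lyapunov–Schmidt with a
# one-dimensional kernel: Vanderbauwhede 1982, Ch. 8; Chow–Hale 1982, §2.4 and Ch. 6; Dancer 1984)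

Analysis/Calculus proof file (Mathlib only; theorems only, no definitions, no named facts).
The elementary functional analysis behind "persistence of a zero along a one-parameter
unfolding direction at a simply degenerate point" — the device by which a zero `u₀` of
`N(u) + frc(c) = 0` whose linearisation `T = DN(u₀)` is Fredholm of index `0` with a
ONE-dimensional kernel `ℝ·g` is continued, NOT as a function of the full parameter `c'`, but
after correcting `c'` along a fixed direction `d` that is *visible at first order*
(`frc d ∉ range T`): one solves the BORDERED system
`(N(u) + frc(c' − t d), φ(u − u₀)) = (0, 0)` for `(u, t)` by the ordinary implicit function
theorem (Chow–Hale 1982, §2.4 "bordered operators" and Ch. 6; Vanderbauwhede 1982, Ch. 8, the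
Lyapunov–Schmidt reduction at a symmetric solution with one-dimensional kernel; Dancer 1984,
perturbation of zeros in the presence of symmetries).

* `bijective_of_injective_of_isCompactOperator` — Fredholm alternative for a compact
  perturbation `T` of a linear homeomorphism `J : X ≃L Y` of real Banach spaces: `T` injective
  ⇒ `T` bijective (Mathlib's `IsCompactOperator.hasEigenvalue_or_mem_resolventSet` at `μ = −1`
  for `J⁻¹(T − J)`).
* `bordered_bijective` — the bordering lemma: if moreover `ker T ⊆ ℝ·g`, `e ∉ range T` and
  `φ g ≠ 0`, the bordered operator `(w, t) ↦ (T w − t e, φ w)` is bijective `X × ℝ → Y × ℝ`.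
* `bordered_implicit` — the bordered implicit function theorem: for `N` of class `C¹` at `u₀`
  with derivative `T`, `frc` continuous linear, `N u₀ + frc c = 0` and the bordered operator (with
  `e = frc d`) bijective, there are `σ : P → ℝ`, `υ : P → X` near `c` with `σ c = 0`, `υ c = u₀`,
  `Dσ(c) d = 1`, `σ` continuous on a ball, `υ` continuous at `c`, solving
  `N (υ c') + frc (c' − σ(c') d) = 0`, `φ (υ c' − u₀) = 0`.
* `malkin_implicit` — the two combined, with the functional `φ` supplied by Hahn–Banach: compact
  perturbation of an isomorphism with `ker T ⊆ ℝ·g` and `frc d ∉ range T` ⇒ the data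
  `(φ, σ, υ, Dσ(c), r)`.

Not here: the group-orbit / Malkin-function analysis that consumes `σ` (summit side), higher
kernel dimension, parameter-dependent `N`.

## References

* A. Vanderbauwhede, *Local Bifurcation and Symmetry*, Research Notes in Mathematics 75, Pitman
  (1982), Ch. 8 (Thm. 8.2.11, §8.5). [Vanderbauwhede1982]
* S.-N. Chow, J. K. Hale, *Methods of Bifurcation Theory*, Grundlehren 251, Springer (1982), §2.4,
  Ch. 6. [ChowHale1982]
* E. N. Dancer, *Perturbation of zeros in the presence of symmetries*, J. Austral. Math. Soc.
  Ser. A 36 (1984) 106–125. [Dancer1984]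
-/

noncomputable section

open scoped Topology
open Filter Set Function

namespace Literature.Analysis.Calculus

section Tools

variable {X Y : Type*} [NormedAddCommGroup X] [NormedSpace ℝ X] [CompleteSpace X]
  [NormedAddCommGroup Y] [NormedSpace ℝ Y]

/-- **Fredholm alternative for a compact perturbation of an isomorphism** (real Banach spaces): if
`T − J` is compact for a linear homeomorphism `J`, then `T` injective ⇒ `T` bijective.  (Mathlib's
`IsCompactOperator.hasEigenvalue_or_mem_resolventSet` at `μ = −1` for `K₀ = J⁻¹(T − J)`.) [folklore] -/
theorem bijective_of_injective_of_isCompactOperator (T : X →L[ℝ] Y) (J : X ≃L[ℝ] Y)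
    (hK : IsCompactOperator (T - (J : X →L[ℝ] Y) : X →L[ℝ] Y)) (hinj : Injective T) :
    Bijective T := by
  set K₀ : X →L[ℝ] X := (J.symm : Y →L[ℝ] X) ∘L (T - (J : X →L[ℝ] Y)) with hK₀
  have hK₀c : IsCompactOperator K₀ := hK.clm_comp (J.symm : Y →L[ℝ] X)
  have hT : ∀ x, T x = J ((1 + K₀) x) := by
    intro x
    simp [hK₀]
  have h1inj : Injective (1 + K₀ : X →L[ℝ] X) := by
    intro x y hxy
    apply hinj
    rw [hT, hT, hxy]
  have hnot : ¬ Module.End.HasEigenvalue (K₀ : Module.End ℝ X) (-1) := by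
    intro h
    obtain ⟨v, hv⟩ := h.exists_hasEigenvector
    have h1 := hv.apply_eq_smul
    have h0 : (1 + K₀) v = 0 := by
      simp only [add_apply, one_apply_eq_self]
      rw [show K₀ v = (K₀ : Module.End ℝ X) v from rfl, h1]
      simp
    exact hv.2 (h1inj (by rw [h0, map_zero]))
  have hres := (IsCompactOperator.hasEigenvalue_or_mem_resolventSet hK₀c (μ := (-1 : ℝ))
    (by norm_num)).resolve_left hnot
  rw [spectrum.mem_resolventSet_iff, ← IsUnit.neg_iff, ContinuousLinearMap.isUnit_iff_bijective] at hres
  have heq : ∀ x, (-(algebraMap ℝ (X →L[ℝ] X) (-1) - K₀)) x = (1 + K₀) x := by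
    intro x
    simp only [Algebra.algebraMap_eq_smul_one, neg_sub, one_apply_eq_self, neg_smul, one_smul,
      sub_neg_eq_add, add_apply]
    exact add_comm _ _
  refine ⟨hinj, fun y => ?_⟩
  obtain ⟨x, hx⟩ := hres.2 (J.symm y)
  refine ⟨x, ?_⟩
  rw [hT, ← heq, hx]
  simp

/-- **The bordering lemma** (real Banach spaces; Chow–Hale 1982 §2.4).  Let `T − J` be compact for a
linear homeomorphism `J : X ≃ Y`, `ker T ⊆ ℝ·g`, `e ∉ range T` and `φ g ≠ 0` for a functional `φ`.
Then the BORDERED operator `(w, t) ↦ (T w − t·e, φ w)` is bijective `X × ℝ → Y × ℝ`.  (By the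
Fredholm alternative `T` is not injective, so `T g = 0`; `T + φ(·) e` is injective, hence
bijective; then solve.) [folklore] -/
theorem bordered_bijective (T : X →L[ℝ] Y) (J : X ≃L[ℝ] Y)
    (hK : IsCompactOperator (T - (J : X →L[ℝ] Y) : X →L[ℝ] Y)) (g : X) (e : Y) (φ : X →L[ℝ] ℝ)
    (hker : ∀ x, T x = 0 → ∃ z : ℝ, x = z • g) (hrange : ∀ x, T x ≠ e) (hφ : φ g ≠ 0) :
    Bijective fun p : X × ℝ => (T p.1 - p.2 • e, φ p.1) := by
  -- `T g = 0`: otherwise `T` is injective, hence bijective, contradicting `e ∉ range T`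
  have hTg : T g = 0 := by
    by_contra hne
    have hinj : Injective T := by
      rw [injective_iff_map_eq_zero]
      intro x hx
      obtain ⟨z, rfl⟩ := hker x hx
      by_cases hz : z = 0
      · rw [hz, zero_smul]
      · rw [map_smul] at hx
        exact absurd ((smul_eq_zero.1 hx).resolve_left hz) hne
    obtain ⟨x, hx⟩ := (bijective_of_injective_of_isCompactOperator T J hK hinj).2 e
    exact hrange x hx
  -- `T₁ := T + φ(·) e` is a compact perturbation of `J` and injective, hence bijective
  set T₁ : X →L[ℝ] Y := T + φ.smulRight e with hT₁
  have hT₁K : IsCompactOperator (T₁ - (J : X →L[ℝ] Y) : X →L[ℝ] Y) := by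
    have hφc : IsCompactOperator (φ : X → ℝ) := isCompactOperator_of_locallyCompactSpace_dom φ
    have hr1 : IsCompactOperator (φ.smulRight e : X → Y) := by
      have h := hφc.clm_comp (ContinuousLinearMap.toSpanSingleton ℝ e)
      have hfe : ((ContinuousLinearMap.toSpanSingleton ℝ e) ∘ (φ : X → ℝ) : X → Y) =
          (φ.smulRight e : X → Y) := by
        funext x
        simp [ContinuousLinearMap.toSpanSingleton_apply]
      rwa [hfe] at h
    have hfun : ((T₁ - (J : X →L[ℝ] Y) : X →L[ℝ] Y) : X → Y) =
        ((T - (J : X →L[ℝ] Y) : X →L[ℝ] Y) : X → Y) + (φ.smulRight e : X → Y) := by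
      funext x
      simp only [hT₁, sub_apply, add_apply, Pi.add_apply]
      abel
    rw [hfun]
    exact hK.add hr1
  have hT₁inj : Injective T₁ := by
    rw [injective_iff_map_eq_zero]
    intro x hx
    have hx' : T x = (-(φ x)) • e := by
      have : T x + φ x • e = 0 := by simpa [hT₁] using hx
      rw [neg_smul, eq_neg_iff_add_eq_zero, this]
    by_cases hφx : φ x = 0
    · rw [hφx, neg_zero, zero_smul] at hx'
      obtain ⟨z, rfl⟩ := hker x hx'
      rw [map_smul, smul_eq_mul, mul_eq_zero] at hφx
      rw [hφx.resolve_right hφ, zero_smul]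
    · exfalso
      refine hrange ((-(φ x))⁻¹ • x) ?_
      rw [map_smul, hx', smul_smul, inv_mul_cancel₀ (neg_ne_zero.2 hφx), one_smul]
  have hT₁bij := bijective_of_injective_of_isCompactOperator T₁ J hT₁K hT₁inj
  refine ⟨?_, ?_⟩
  · rintro ⟨w, t⟩ ⟨w', t'⟩ h
    simp only [Prod.mk.injEq] at h
    obtain ⟨h1, h2⟩ := h
    have h3 : T (w - w') = (t - t') • e := by
      rw [map_sub, sub_smul]
      rw [sub_eq_iff_eq_add] at h1
      rw [h1]
      abel
    by_cases ht : t = t'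
    · subst ht
      rw [sub_self, zero_smul] at h3
      obtain ⟨z, hz⟩ := hker _ h3
      have hφz : φ (w - w') = 0 := by rw [map_sub, h2, sub_self]
      rw [hz, map_smul, smul_eq_mul, mul_eq_zero] at hφz
      have hz0 : z = 0 := hφz.resolve_right hφ
      rw [hz0, zero_smul, sub_eq_zero] at hz
      rw [hz]
    · exfalso
      refine hrange ((t - t')⁻¹ • (w - w')) ?_
      rw [map_smul, h3, smul_smul, inv_mul_cancel₀ (sub_ne_zero.2 ht), one_smul]
  · rintro ⟨h, r⟩
    obtain ⟨x₁, hx₁⟩ := hT₁bij.2 h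
    have hx₁' : T x₁ + φ x₁ • e = h := by simpa [hT₁] using hx₁
    refine ⟨(x₁ + ((r - φ x₁) / φ g) • g, -φ x₁), ?_⟩
    simp only [Prod.mk.injEq, map_add, map_smul, hTg, smul_zero, add_zero, neg_smul, sub_neg_eq_add,
      smul_eq_mul]
    exact ⟨hx₁', by field_simp; ring⟩

section Implicit

variable [CompleteSpace Y] {P : Type*} [NormedAddCommGroup P] [NormedSpace ℝ P] [CompleteSpace P]

/-- **The bordered implicit function theorem** (Chow–Hale 1982 Ch. 6; Vanderbauwhede 1982 §8.5).  Let
`N : X → Y` be `C¹` at `u₀` with derivative `T`, `frc : P → Y` continuous linear, `N u₀ + frc c = 0`,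
and let the bordered operator `(w, t) ↦ (T w − t·frc d, φ w)` be bijective.  Then there are
`σ : P → ℝ`, `υ : P → X`, continuous near / at `c`, with `σ c = 0`, `υ c = u₀`, `Dσ(c) d = 1`, solving
`N (υ c') + frc (c' − σ(c') d) = 0`, `φ (υ c' − u₀) = 0` on a ball around `c`. [folklore] -/
theorem bordered_implicit (N : X → Y) (frc : P →L[ℝ] Y) (T : X →L[ℝ] Y) (φ : X →L[ℝ] ℝ) (u₀ : X)
    (c d : P) (hN : ContDiffAt ℝ 1 N u₀) (hT : HasFDerivAt N T u₀) (h0 : N u₀ + frc c = 0)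
    (hD : Bijective fun p : X × ℝ => (T p.1 - p.2 • frc d, φ p.1)) :
    ∃ (σ : P → ℝ) (υ : P → X) (ℓ : P →L[ℝ] ℝ) (r : ℝ), 0 < r ∧ σ c = 0 ∧ υ c = u₀ ∧
      HasFDerivAt σ ℓ c ∧ ℓ d = 1 ∧ ContinuousOn σ (Metric.ball c r) ∧ ContinuousAt υ c ∧
      ∀ c' ∈ Metric.ball c r, N (υ c') + frc (c' - σ c' • d) = 0 ∧ φ (υ c' - u₀) = 0 := by
  -- the bordered map `Φ(c', (u, t)) = (N u + frc (c' − t d), φ (u − u₀))` and its base point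
  set Φ : P × (X × ℝ) → Y × ℝ := fun q => (N q.2.1 + frc (q.1 - q.2.2 • d), φ (q.2.1 - u₀)) with hΦ
  set pt : P × (X × ℝ) := (c, (u₀, 0)) with hpt
  have hΦpt : Φ pt = 0 := by simp [hΦ, hpt, h0]
  -- projections and the derivative of `Φ` at `pt`
  set πu : P × (X × ℝ) →L[ℝ] X :=
    (ContinuousLinearMap.fst ℝ X ℝ).comp (ContinuousLinearMap.snd ℝ P (X × ℝ)) with hπu
  set πt : P × (X × ℝ) →L[ℝ] ℝ :=
    (ContinuousLinearMap.snd ℝ X ℝ).comp (ContinuousLinearMap.snd ℝ P (X × ℝ)) with hπt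
  set πc : P × (X × ℝ) →L[ℝ] P := ContinuousLinearMap.fst ℝ P (X × ℝ) with hπc
  set Φ' : P × (X × ℝ) →L[ℝ] Y × ℝ := (T.comp πu + frc.comp (πc - πt.smulRight d)).prod (φ.comp πu)
    with hΦ'
  have hπupt : πu pt = u₀ := rfl
  have hΦd : HasFDerivAt Φ Φ' pt := by
    have h1 : HasFDerivAt (fun q : P × (X × ℝ) => N q.2.1) (T.comp πu) pt := by
      have hT' : HasFDerivAt N T (πu pt) := by rw [hπupt]; exact hT
      exact hT'.comp pt πu.hasFDerivAt
    have h2 : HasFDerivAt (fun q : P × (X × ℝ) => frc (q.1 - q.2.2 • d)) (frc.comp (πc - πt.smulRight d)) pt := by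
      have e2 : (fun q : P × (X × ℝ) => frc (q.1 - q.2.2 • d)) = ⇑(frc.comp (πc - πt.smulRight d)) := by
        funext q; simp [hπc, hπt]
      rw [e2]; exact (frc.comp (πc - πt.smulRight d)).hasFDerivAt
    have h3 : HasFDerivAt (fun q : P × (X × ℝ) => φ (q.2.1 - u₀)) (φ.comp πu) pt := by
      have e3 : (fun q : P × (X × ℝ) => φ (q.2.1 - u₀)) = fun q => (φ.comp πu) q - φ u₀ := by
        funext q; simp [hπu, map_sub]
      rw [e3]; exact (φ.comp πu).hasFDerivAt.sub_const (φ u₀)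
    exact (h1.add h2).prodMk h3
  have hΦc : ContDiffAt ℝ 1 Φ pt := by
    have h1 : ContDiffAt ℝ 1 (fun q : P × (X × ℝ) => N q.2.1) pt := by
      have hN' : ContDiffAt ℝ 1 N (πu pt) := by rw [hπupt]; exact hN
      exact hN'.comp pt πu.contDiff.contDiffAt
    have h2 : ContDiffAt ℝ 1 (fun q : P × (X × ℝ) => frc (q.1 - q.2.2 • d)) pt := by
      have e2 : (fun q : P × (X × ℝ) => frc (q.1 - q.2.2 • d)) = ⇑(frc.comp (πc - πt.smulRight d)) := by
        funext q; simp [hπc, hπt]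
      rw [e2]; exact (frc.comp (πc - πt.smulRight d)).contDiff.contDiffAt
    have h3 : ContDiffAt ℝ 1 (fun q : P × (X × ℝ) => φ (q.2.1 - u₀)) pt := by
      have e3 : (fun q : P × (X × ℝ) => φ (q.2.1 - u₀)) = fun q => (φ.comp πu) q - φ u₀ := by
        funext q; simp [hπu, map_sub]
      rw [e3]; exact (φ.comp πu).contDiff.contDiffAt.sub contDiffAt_const
    exact (h1.add h2).prodMk h3
  -- the partial derivative in `(u, t)` is the bordered operator, which is invertible
  have hinr : ⇑(Φ' ∘L ContinuousLinearMap.inr ℝ P (X × ℝ)) = fun p : X × ℝ => (T p.1 - p.2 • frc d, φ p.1) := by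
    funext p
    obtain ⟨w, t⟩ := p
    simp [hΦ', hπu, hπt, hπc, sub_eq_add_neg]
  have if₂ : (fderiv ℝ Φ pt ∘L ContinuousLinearMap.inr ℝ P (X × ℝ)).IsInvertible := by
    rw [hΦd.fderiv]
    have hb : Bijective (Φ' ∘L ContinuousLinearMap.inr ℝ P (X × ℝ)) := by rw [hinr]; exact hD
    exact ⟨ContinuousLinearEquiv.ofBijective _ (LinearMap.ker_eq_bot.2 hb.1) (LinearMap.range_eq_top.2 hb.2),
      ContinuousLinearEquiv.coe_ofBijective _ _ _⟩
  -- the implicit function `ψ = (υ, σ)`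
  set ψ : P → X × ℝ := hΦc.implicitFunction one_ne_zero if₂ with hψ
  have hψc : ψ c = (u₀, 0) := hΦc.implicitFunction_apply_self one_ne_zero if₂
  have hev : ∀ᶠ x in 𝓝 c, Φ (x, ψ x) = Φ pt := hΦc.eventually_apply_implicitFunction one_ne_zero if₂
  have huniq : ∀ᶠ v in 𝓝 pt, Φ v = Φ pt ↔ ψ v.1 = v.2 :=
    hΦc.eventually_apply_eq_iff_implicitFunction one_ne_zero if₂
  have hψd : ContDiffAt ℝ 1 ψ c := hΦc.contDiffAt_implicitFunction one_ne_zero if₂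
  set σ : P → ℝ := fun x => (ψ x).2 with hσ
  set υ : P → X := fun x => (ψ x).1 with hυ
  have hσd : ContDiffAt ℝ 1 σ c := contDiffAt_snd.comp c hψd
  have hσfd : HasFDerivAt σ (fderiv ℝ σ c) c := (hσd.differentiableAt (by norm_num)).hasFDerivAt
  -- `σ (c + t d) = t` for small `t` (uniqueness), hence `Dσ(c) d = 1`
  have hline : (fun t : ℝ => σ (c + t • d)) =ᶠ[𝓝 0] fun t => t := by
    have hγ : Continuous fun t : ℝ => ((c + t • d, (u₀, t)) : P × (X × ℝ)) := by fun_prop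
    have hγ0 : (fun t : ℝ => ((c + t • d, (u₀, t)) : P × (X × ℝ))) 0 = pt := by simp [hpt]
    have hte : Tendsto (fun t : ℝ => ((c + t • d, (u₀, t)) : P × (X × ℝ))) (𝓝 0) (𝓝 pt) := by
      rw [← hγ0]; exact hγ.continuousAt
    filter_upwards [hte.eventually huniq] with t ht
    have hΦγ : Φ (c + t • d, (u₀, t)) = Φ pt := by
      rw [hΦpt]; simp [hΦ, h0]
    have h := ht.1 hΦγ
    show (ψ (c + t • d)).2 = t
    rw [h]
  have hℓd : fderiv ℝ σ c d = 1 := by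
    have hl : HasDerivAt (fun t : ℝ => c + t • d) d 0 := by
      simpa using ((hasDerivAt_id (0 : ℝ)).smul_const d).const_add c
    have hσ0 : HasFDerivAt σ (fderiv ℝ σ c) (c + (0 : ℝ) • d) := by simpa using hσfd
    have h1 : HasDerivAt (fun t : ℝ => σ (c + t • d)) (fderiv ℝ σ c d) 0 := by
      have h := hσ0.comp_hasDerivAt (0 : ℝ) hl
      exact h
    have h2 : HasDerivAt (fun t : ℝ => σ (c + t • d)) 1 0 := (hasDerivAt_id' (0 : ℝ)).congr_of_eventuallyEq hline
    exact h1.unique h2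
  -- a ball on which everything holds
  have hσcont : ∀ᶠ x in 𝓝 c, ContDiffAt ℝ 1 σ x := hσd.eventually (by simp)
  obtain ⟨r, hr, hball⟩ := Metric.eventually_nhds_iff.1 (hev.and hσcont)
  refine ⟨σ, υ, fderiv ℝ σ c, r, hr, by simp [hσ, hψc], by simp [hυ, hψc], hσfd, hℓd,
    fun x hx => ((hball (Metric.mem_ball.1 hx)).2.continuousAt).continuousWithinAt,
    hψd.continuousAt.fst, fun x hx => ?_⟩
  have hx' := (hball (Metric.mem_ball.1 hx)).1
  rw [hΦpt] at hx'
  simp only [hΦ, Prod.mk_eq_zero] at hx'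
  exact hx'

/-- **The Malkin implicit function theorem (abstract; Vanderbauwhede 1982 Thm 8.2.11, Dancer 1984).**
Compact perturbation of a linear homeomorphism with kernel inside `ℝ·g` and `frc d` outside the range
⇒ the bordered persistence data `(σ, υ, ℓ, r)` of `bordered_implicit`, for a suitable functional `φ`
(Hahn–Banach). [folklore] -/
theorem malkin_implicit (N : X → Y) (frc : P →L[ℝ] Y) (T : X →L[ℝ] Y) (J : X ≃L[ℝ] Y) (u₀ g : X)
    (c d : P) (hN : ContDiffAt ℝ 1 N u₀) (hT : HasFDerivAt N T u₀) (h0 : N u₀ + frc c = 0)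
    (hK : IsCompactOperator (T - (J : X →L[ℝ] Y) : X →L[ℝ] Y))
    (hker : ∀ x, T x = 0 → ∃ z : ℝ, x = z • g) (hrange : ∀ x, T x ≠ frc d) :
    ∃ (φ : X →L[ℝ] ℝ) (σ : P → ℝ) (υ : P → X) (ℓ : P →L[ℝ] ℝ) (r : ℝ), 0 < r ∧ σ c = 0 ∧ υ c = u₀ ∧
      HasFDerivAt σ ℓ c ∧ ℓ d = 1 ∧ ContinuousOn σ (Metric.ball c r) ∧ ContinuousAt υ c ∧
      ∀ c' ∈ Metric.ball c r, N (υ c') + frc (c' - σ c' • d) = 0 ∧ φ (υ c' - u₀) = 0 := by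
  have hg : g ≠ 0 := by
    intro hg
    have hinj : Injective T := by
      rw [injective_iff_map_eq_zero]
      intro x hx
      obtain ⟨z, rfl⟩ := hker x hx
      rw [hg, smul_zero]
    obtain ⟨x, hx⟩ := (bijective_of_injective_of_isCompactOperator T J hK hinj).2 (frc d)
    exact hrange x hx
  have hgn : ‖g‖ ≠ 0 := norm_ne_zero_iff.2 hg
  obtain ⟨φ, -, hφg⟩ := exists_dual_vector ℝ g hgn
  have hφ : φ g ≠ 0 := by
    rw [hφg]
    exact_mod_cast hgn
  obtain ⟨σ, υ, ℓ, r, h⟩ := bordered_implicit N frc T φ u₀ c d hN hT h0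
    (bordered_bijective T J hK g (frc d) φ hker hrange hφ)
  exact ⟨φ, σ, υ, ℓ, r, h⟩

end Implicit

end Tools

end Literature.Analysis.Calculus

end
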